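import Mathlib
import Literature.MathematicalPhysics.QuantumLattice.InfiniteVolumeStatesProofs
import Literature.MathematicalPhysics.QuantumLattice.HeisenbergWindowCertificate
import Literature.MathematicalPhysics.QuantumLattice.InfVolFermionState
import HarnessLib

/-!
# Thermodynamic limits of quantum SPIN states along tori: the torus-limit states of `ℤ^d` and
# their existence (weak-⋆ compactness)

Topic `Literature/MathematicalPhysics/QuantumLattice`; namespace
`Literature.MathematicalPhysics.QuantumLattice` (the file path). The spin-system twin of the fermionic
`InfVolFermionState.IsTorusLimitOf` (`InfVolFermionState.lean`) and of
`InfVolFermionStateCompactness.lean`, written for the Koma–Tasaki / Dyson–Lieb–Simon infinite-volume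
statements for quantum spins (`HeisenbergAFInfiniteVolumeNeelOrder.lean`): the tree's long-range-order and
spontaneous-magnetisation theorems for the Heisenberg / XXZ antiferromagnets and hard-core lattice bosons are
finite-volume statements on the discrete tori `(ℤ/Lℤ)^d` (reflection positivity needs periodic boundary
conditions), while the tree's infinite-volume spin states `InfVolState d q` (`InfiniteVolumeStates.lean`,
Bratteli–Robinson II §6.2.1: compatible families of states on the local algebras `𝔄_Λ = Op ↥Λ q`,
`Λ ⊆ ℤ^d` finite) so far only come with thermodynamic limits along open BOXES (`InfVolState.IsBoxLimitOf`,
`IsGibbsBoxLimitOf`). This file supplies the limit along tori.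

## Contents (everything PROVED; two definitions, no named fact)

* `torusSpinExpect L Λ A ρ` — the expectation, in a finite-volume state `ρ` of the spin system on the
  torus `(ℤ/Lℤ)^d` (a linear functional on `Op (TorusSite d L) q`; e.g. a Gibbs state `Matrix.gibbsState β H`
  or the tracial ground state `Matrix.groundStateFunctional H`), of the local observable `A ∈ 𝔄_Λ` pulled
  into the torus along `x ↦ x mod L` (`spinEmbed (spinToTorusEmb L h) A`, the tree's second quantisation
  of the site injection, `SpinEmbedding.lean` / `HeisenbergWindowCertificate.lean`) — junk value `0` for the
  finitely many `L` for which `x ↦ x mod L` is not injective on `Λ`.  Linearity in `A`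
  (`torusSpinExpect_sum_smul`, `torusSpinExpect_eq_sum_single`), normalisation (`torusSpinExpect_one`),
  positivity (`torusSpinExpect_conjTranspose_mul_self_nonneg`), compatibility with isotony
  (`torusSpinExpect_embedOp`), the uniform bound `≤ 1` on matrix units (`norm_torusSpinExpect_single_le`),
  single-site observables (`torusSpinExpect_onSite`).
* `InfVolState.IsTorusLimitOf ω ρ` — `ω` is the thermodynamic limit of the torus states `ρ j` (on the tori
  of sides `Ls j`): `torusSpinExpect (Ls j) Λ A (ρ j) → ω_Λ(A)` for every finite `Λ` and every `A ∈ 𝔄_Λ`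
  (weak-⋆ convergence on the dense local algebra; Bratteli–Robinson II §6.2.2, periodic boundary conditions).
  API: `tendsto_onSite` (one-site expectations converge WITHOUT junk values), `tendsto_corr`,
  `shift_eq_of_invariant` (invariance of the `ρ j` under a torus translation passes to `τ_v`-invariance of
  `ω`), `isTranslationInvariant`.
* `InfVolState.exists_isTorusLimitOf_subseq` — **THERMODYNAMIC-LIMIT STATES EXIST**: for normalised positive
  functionals `ρ j` on the tori of sides `Ls j → ∞` there are a subsequence `φ` and an infinite-volume state
  `ω` with `ω.IsTorusLimitOf (ρ ∘ φ)` (sequential Banach–Alaoglu, Bratteli–Robinson I Thm. 2.3.15, by the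
  Cantor–Tychonoff diagonal argument on the countably many matrix-unit coordinates, each of modulus `≤ 1`;
  linearity, normalisation, positivity and compatibility of the limit are closed conditions).
* `InfVolState.exists_tendsto_expect_subseq` — sequential weak-⋆ compactness of the spin state space itself
  (every sequence of `InfVolState`s has a pointwise convergent subsequence; the fermionic twin is
  `InfVolFermionState.exists_tendsto_expect_subseq`), used for the second limit `B ↓ 0` of Koma–Tasaki's
  infinitesimal-field states; `InfVolState.shift_eq_of_tendsto_expect` (invariance under a translation is
  closed).
* Tools: `state_norm_apply_le` (`|ρ(X)| ≤ ‖X‖` for a normalised positive functional on a full matrix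
  algebra, from the tree's `PositiveLinearMap.norm_apply_le_of_map_one`), `norm_spinEmbed_single_le_one`
  (an embedded matrix unit is a partial isometry), `spinEmbed_siteIncl_eq_embedOp` (the tree's two isotony
  maps agree), `spinEmbed_toTorus_transportOp_shift` (translating the region = conjugating by the torus
  translation unitary `permOp (torusAff 1 (v mod L))`).

## References
* O. Bratteli, D. W. Robinson, *Operator Algebras and Quantum Statistical Mechanics 1*, 2nd ed. (Springer
  1987): Thm. 2.3.15 (the state space is weak-⋆ compact), Prop. 2.3.11 (states are contractive), §4.3.1
  (invariant states). [BratteliRobinsonI1987]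
* O. Bratteli, D. W. Robinson, *Operator Algebras and Quantum Statistical Mechanics 2*, 2nd ed. (Springer
  1997): §6.2.1 (quasi-local algebra of a quantum spin system, isotony, translations), §6.2.2
  (thermodynamic limit of finite-volume Gibbs states, periodic boundary conditions). [BratteliRobinsonII1997]
* T. Koma, H. Tasaki, Commun. Math. Phys. **158** (1993) 191–214, §1 eq. (1.5), (1.8) (the infinite-volume
  states `ω₀ = lim_Λ ⟨·⟩_Λ` and `ω̃ = lim_{B↓0} lim_Λ ⟨·⟩_{Λ,B}` of the Heisenberg antiferromagnet along
  periodic boxes). [KomaTasaki1993]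

## What is NOT here
No uniqueness of limits (none in general), no identification of limits of Gibbs states as KMS states or of
limits of ground states as infinite-volume ground states (model files do the latter where needed), nothing
model-specific.
-/

noncomputable section

namespace Literature.MathematicalPhysics.QuantumLattice

open Matrix Finset _root_.Filter Literature.Probability.LatticeModels
open scoped _root_.Topology ComplexOrder

/-! ### Normalised positive functionals on a full matrix algebra are contractive -/

section StateBounds

variable {Y : Type*} [Fintype Y] [DecidableEq Y] {q : ℕ}

open scoped MatrixOrder in
/-- A functional that is nonnegative on the `Aᴴ A` is nonnegative on the whole positive cone of the matrix
algebra (the cone is the closed additive span of the `Aᴴ A`; Bratteli–Robinson I, remark after Def. 2.3.9).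
[cite: BratteliRobinsonI1987, Def. 2.3.9] -/
theorem state_nonneg_of_nonneg (ρ : Op Y q →ₗ[ℂ] ℂ) (hpos : ∀ A : Op Y q, 0 ≤ ρ (Aᴴ * A))
    {A : Op Y q} (hA : 0 ≤ A) : 0 ≤ ρ A := by
  rw [StarOrderedRing.nonneg_iff] at hA
  induction hA using AddSubmonoid.closure_induction with
  | mem x hx =>
    obtain ⟨B, rfl⟩ := hx
    exact hpos B
  | zero => simp
  | add x y _ _ hx hy =>
    rw [map_add]
    exact add_nonneg hx hy

open scoped MatrixOrder Matrix.Norms.L2Operator in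
/-- **States are contractive**: a normalised (`ρ(𝟙) = 1`) positive (`ρ(Aᴴ A) ≥ 0`) linear functional on the
matrix algebra `𝔄_Y = Op Y q` satisfies `|ρ(X)| ≤ ‖X‖` (L²-operator norm).  Bratteli–Robinson I Prop. 2.3.11,
through the tree's `PositiveLinearMap.norm_apply_le_of_map_one`. [cite: BratteliRobinsonI1987, Prop. 2.3.11] -/
theorem state_norm_apply_le (ρ : Op Y q →ₗ[ℂ] ℂ) (h1 : ρ 1 = 1) (hpos : ∀ A : Op Y q, 0 ≤ ρ (Aᴴ * A))
    (X : Op Y q) : ‖ρ X‖ ≤ ‖X‖ := by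
  letI : CStarAlgebra (Op Y q) := {}
  exact Literature.MathematicalPhysics.QuantumLattice.PositiveLinearMap.norm_apply_le_of_map_one
    (.mk₀ ρ fun _ hB => state_nonneg_of_nonneg ρ hpos hB) h1 X

open scoped Matrix.Norms.L2Operator in
/-- **An embedded matrix unit has operator norm `≤ 1`**: for a site injection `φ : X ↪ Y` and configurations
`s, t` of `X`, `E = Γ_φ(|s⟩⟨t|)` satisfies `Eᴴ E = Γ_φ(|t⟩⟨t|) = P` with `P = Pᴴ = P²`, so `‖P‖ = ‖P‖²`, `‖P‖ ≤ 1`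
and `‖E‖² = ‖Eᴴ E‖ ≤ 1` (C⋆-identity). [cite: BratteliRobinsonII1997, §6.2.1] -/
theorem norm_spinEmbed_single_le_one {X : Type*} [Fintype X] [DecidableEq X] (φ : X ↪ Y)
    (s t : TensorIndex X q) : ‖spinEmbed φ (Matrix.single s t (1 : ℂ) : Op X q)‖ ≤ 1 := by
  set E : Op Y q := spinEmbed φ (Matrix.single s t (1 : ℂ) : Op X q) with hE
  set P : Op Y q := spinEmbed φ (Matrix.single t t (1 : ℂ) : Op X q) with hP
  have hEE : Eᴴ * E = P := by
    rw [hE, ← spinEmbed_conjTranspose, ← map_mul, Matrix.conjTranspose_single, star_one,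
      Matrix.single_mul_single_same, one_mul]
  have hPh : Pᴴ = P := by
    rw [hP, ← spinEmbed_conjTranspose, Matrix.conjTranspose_single, star_one]
  have hPP : Pᴴ * P = P := by
    rw [hPh, hP, ← map_mul, Matrix.single_mul_single_same, one_mul]
  have hnP : ‖P‖ * ‖P‖ = ‖P‖ := by
    rw [← CStarRing.norm_star_mul_self, Matrix.star_eq_conjTranspose, hPP]
  have hP1 : ‖P‖ ≤ 1 := by
    by_cases h0 : ‖P‖ = 0
    · rw [h0]; exact zero_le_one
    · exact le_of_eq (mul_left_cancel₀ h0 (by rw [hnP, mul_one]))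
  have hnE : ‖E‖ * ‖E‖ ≤ 1 := by
    rw [← CStarRing.norm_star_mul_self, Matrix.star_eq_conjTranspose, hEE]
    exact hP1
  nlinarith [norm_nonneg E]

end StateBounds

/-! ### Pulling local observables of `ℤ^d` into the torus `(ℤ/Lℤ)^d` -/

section TorusExpect

variable {d q : ℕ}

/-- The two isotony maps of the tree agree: `Γ_{incl}(A) = embedOp h A = A ⊗ 𝟙_{Λ'∖Λ}` for `Λ ⊆ Λ'`
(`spinEmbed` along `siteIncl h`, `SpinEmbedding.lean`, versus `embedOp h`, `SpinSystem.lean`).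
[cite: BratteliRobinsonII1997, §6.2.1] -/
theorem spinEmbed_siteIncl_eq_embedOp {Λ Λ' : Finset (Site d)} (h : Λ ⊆ Λ') (A : Op ↥Λ q) :
    spinEmbed (siteIncl h) A = embedOp h A := by
  ext σ τ
  rw [spinEmbed_apply, embedOp, of_apply]
  have hc : (∀ y : ↥Λ', (y ∉ Set.range (siteIncl h)) → σ y = τ y) ↔
      (∀ y : ↥Λ', (y : Site d) ∉ Λ → σ y = τ y) := by
    refine forall_congr' fun y => imp_congr_left ⟨fun hy hm => hy ⟨⟨y, hm⟩, Subtype.ext rfl⟩, ?_⟩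
    rintro hy ⟨x, rfl⟩
    exact hy x.2
  rw [if_congr hc rfl rfl]
  rfl

variable (L : ℕ) [NeZero L]

/-- **The torus expectation of a local observable.**  For a finite-volume state `ρ` of the quantum spin
system on the torus `(ℤ/Lℤ)^d` (a linear functional on `𝔄_{(ℤ/Lℤ)^d} = Op (TorusSite d L) q`), a finite region
`Λ ⊆ ℤ^d` and `A ∈ 𝔄_Λ`: the value of `ρ` on `A` pulled into the torus along `x ↦ x mod L`
(`spinEmbed (spinToTorusEmb L h) A = A ⊗ 𝟙` relabelled), when `x ↦ x mod L` is injective on `Λ`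
(i.e. for all `L` larger than the diameter of `Λ`); junk value `0` otherwise.  Bratteli–Robinson II §6.2.2
(finite-volume states with periodic boundary conditions viewed on the local algebras); Koma–Tasaki 1993 §1
(1.5). [cite: BratteliRobinsonII1997, §6.2.2] -/
def torusSpinExpect (Λ : Finset (Site d)) (A : Op ↥Λ q) (ρ : Op (TorusSite d L) q →ₗ[ℂ] ℂ) : ℂ :=
  if h : Set.InjOn (Torus.proj (d := d) L) ↑Λ then ρ (spinEmbed (spinToTorusEmb L h) A) else 0

variable {L}

/-- `torusSpinExpect` when the region fits into the torus. [cite: BratteliRobinsonII1997, §6.2.2] -/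
theorem torusSpinExpect_of_injOn {Λ : Finset (Site d)} (h : Set.InjOn (Torus.proj (d := d) L) ↑Λ)
    (A : Op ↥Λ q) (ρ : Op (TorusSite d L) q →ₗ[ℂ] ℂ) :
    torusSpinExpect L Λ A ρ = ρ (spinEmbed (spinToTorusEmb L h) A) := by
  rw [torusSpinExpect, dif_pos h]

/-- `torusSpinExpect` is the junk value `0` when the region does not fit into the torus. [cite: BratteliRobinsonII1997, §6.2.2] -/
theorem torusSpinExpect_of_not_injOn {Λ : Finset (Site d)} (h : ¬ Set.InjOn (Torus.proj (d := d) L) ↑Λ)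
    (A : Op ↥Λ q) (ρ : Op (TorusSite d L) q →ₗ[ℂ] ℂ) : torusSpinExpect L Λ A ρ = 0 := by
  rw [torusSpinExpect, dif_neg h]

/-- Linearity in the observable: finite linear combinations. [cite: BratteliRobinsonII1997, §6.2.2] -/
theorem torusSpinExpect_sum_smul (Λ : Finset (Site d)) {κ : Type*} (S : Finset κ) (c : κ → ℂ)
    (A : κ → Op ↥Λ q) (ρ : Op (TorusSite d L) q →ₗ[ℂ] ℂ) :
    torusSpinExpect L Λ (∑ k ∈ S, c k • A k) ρ = ∑ k ∈ S, c k * torusSpinExpect L Λ (A k) ρ := by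
  by_cases h : Set.InjOn (Torus.proj (d := d) L) ↑Λ
  · simp_rw [torusSpinExpect_of_injOn h, map_sum, map_smul, smul_eq_mul]
  · simp_rw [torusSpinExpect_of_not_injOn h, mul_zero, Finset.sum_const_zero]

/-- Linearity in the observable: sums. [cite: BratteliRobinsonII1997, §6.2.2] -/
theorem torusSpinExpect_add (Λ : Finset (Site d)) (A B : Op ↥Λ q) (ρ : Op (TorusSite d L) q →ₗ[ℂ] ℂ) :
    torusSpinExpect L Λ (A + B) ρ = torusSpinExpect L Λ A ρ + torusSpinExpect L Λ B ρ := by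
  by_cases h : Set.InjOn (Torus.proj (d := d) L) ↑Λ
  · simp_rw [torusSpinExpect_of_injOn h, map_add]
  · simp_rw [torusSpinExpect_of_not_injOn h, add_zero]

/-- Linearity in the observable: scalars. [cite: BratteliRobinsonII1997, §6.2.2] -/
theorem torusSpinExpect_smul (Λ : Finset (Site d)) (c : ℂ) (A : Op ↥Λ q) (ρ : Op (TorusSite d L) q →ₗ[ℂ] ℂ) :
    torusSpinExpect L Λ (c • A) ρ = c * torusSpinExpect L Λ A ρ := by
  by_cases h : Set.InjOn (Torus.proj (d := d) L) ↑Λ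
  · simp_rw [torusSpinExpect_of_injOn h, map_smul, smul_eq_mul]
  · simp_rw [torusSpinExpect_of_not_injOn h, mul_zero]

/-- Linearity in the state. [cite: BratteliRobinsonII1997, §6.2.2] -/
theorem torusSpinExpect_add_state (Λ : Finset (Site d)) (A : Op ↥Λ q) (ρ ρ' : Op (TorusSite d L) q →ₗ[ℂ] ℂ) :
    torusSpinExpect L Λ A (ρ + ρ') = torusSpinExpect L Λ A ρ + torusSpinExpect L Λ A ρ' := by
  by_cases h : Set.InjOn (Torus.proj (d := d) L) ↑Λ
  · simp_rw [torusSpinExpect_of_injOn h, LinearMap.add_apply]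
  · simp_rw [torusSpinExpect_of_not_injOn h, add_zero]

/-- Homogeneity in the state. [cite: BratteliRobinsonII1997, §6.2.2] -/
theorem torusSpinExpect_smul_state (Λ : Finset (Site d)) (A : Op ↥Λ q) (c : ℂ) (ρ : Op (TorusSite d L) q →ₗ[ℂ] ℂ) :
    torusSpinExpect L Λ A (c • ρ) = c * torusSpinExpect L Λ A ρ := by
  by_cases h : Set.InjOn (Torus.proj (d := d) L) ↑Λ
  · simp_rw [torusSpinExpect_of_injOn h, LinearMap.smul_apply, smul_eq_mul]
  · simp_rw [torusSpinExpect_of_not_injOn h, mul_zero]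

/-- **Expansion in matrix units**: the torus expectation of `A ∈ 𝔄_Λ` is `Σ_{s,t} A_{st} ·` (torus expectation
of the matrix unit `|s⟩⟨t|`). [cite: BratteliRobinsonI1987, §2.6] -/
theorem torusSpinExpect_eq_sum_single (Λ : Finset (Site d)) (A : Op ↥Λ q) (ρ : Op (TorusSite d L) q →ₗ[ℂ] ℂ) :
    torusSpinExpect L Λ A ρ = ∑ s, ∑ t, A s t * torusSpinExpect L Λ (Matrix.single s t (1 : ℂ)) ρ := by
  have hA : A = ∑ p : TensorIndex ↥Λ q × TensorIndex ↥Λ q, A p.1 p.2 • Matrix.single p.1 p.2 (1 : ℂ) := by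
    conv_lhs => rw [matrix_eq_sum_single A, ← Fintype.sum_prod_type']
    refine Finset.sum_congr rfl fun p _ => ?_
    rw [smul_single, smul_eq_mul, mul_one]
  conv_lhs => rw [hA]
  rw [torusSpinExpect_sum_smul, ← Fintype.sum_prod_type']

/-- **Normalisation**: once `Λ` fits into the torus, the torus expectation of `𝟙 ∈ 𝔄_Λ` in a normalised
functional is `1` (`Γ(𝟙) = 𝟙`). [cite: BratteliRobinsonII1997, §6.2.2] -/
theorem torusSpinExpect_one {Λ : Finset (Site d)} (h : Set.InjOn (Torus.proj (d := d) L) ↑Λ)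
    {ρ : Op (TorusSite d L) q →ₗ[ℂ] ℂ} (hρ : ρ 1 = 1) : torusSpinExpect L Λ (1 : Op ↥Λ q) ρ = 1 := by
  rw [torusSpinExpect_of_injOn h, map_one, hρ]

/-- **Positivity**: the torus expectation of `Aᴴ A` in a positive functional is nonnegative (`Γ` is a
`*`-homomorphism; the junk branch gives `0`). [cite: BratteliRobinsonII1997, §6.2.2] -/
theorem torusSpinExpect_conjTranspose_mul_self_nonneg (Λ : Finset (Site d)) (A : Op ↥Λ q)
    {ρ : Op (TorusSite d L) q →ₗ[ℂ] ℂ} (hρ : ∀ X : Op (TorusSite d L) q, 0 ≤ ρ (Xᴴ * X)) :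
    0 ≤ torusSpinExpect L Λ (Aᴴ * A) ρ := by
  by_cases h : Set.InjOn (Torus.proj (d := d) L) ↑Λ
  · rw [torusSpinExpect_of_injOn h, map_mul, spinEmbed_conjTranspose]
    exact hρ _
  · rw [torusSpinExpect_of_not_injOn h]

/-- **Compatibility with isotony at finite side**: for `Λ ⊆ Λ'` fitting into the torus, the torus
expectation of `embedOp h A = A ⊗ 𝟙 ∈ 𝔄_{Λ'}` equals that of `A ∈ 𝔄_Λ` (functoriality
`Γ(ι_{Λ',L}) ∘ Γ(Λ ⊆ Λ') = Γ(ι_{Λ,L})`, tree `spinEmbed_toTorus_incl`). [cite: BratteliRobinsonII1997, §6.2.1] -/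
theorem torusSpinExpect_embedOp {Λ Λ' : Finset (Site d)} (hΛ : Λ ⊆ Λ')
    (h' : Set.InjOn (Torus.proj (d := d) L) ↑Λ') (A : Op ↥Λ q) (ρ : Op (TorusSite d L) q →ₗ[ℂ] ℂ) :
    torusSpinExpect L Λ' (embedOp hΛ A) ρ = torusSpinExpect L Λ A ρ := by
  have h : Set.InjOn (Torus.proj (d := d) L) ↑Λ := h'.mono (by exact_mod_cast hΛ)
  rw [torusSpinExpect_of_injOn h', torusSpinExpect_of_injOn h, ← spinEmbed_siteIncl_eq_embedOp,
    spinEmbed_toTorus_incl hΛ h']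

/-- **Uniform bound on matrix units**: in a normalised positive functional the torus expectation of a
matrix unit `|s⟩⟨t| ∈ 𝔄_Λ` has modulus `≤ 1` (states are contractive and the embedded matrix unit has norm
`≤ 1`; the junk branch gives `0`). [cite: BratteliRobinsonI1987, Prop. 2.3.11] -/
theorem norm_torusSpinExpect_single_le (Λ : Finset (Site d)) (s t : TensorIndex ↥Λ q)
    {ρ : Op (TorusSite d L) q →ₗ[ℂ] ℂ} (h1 : ρ 1 = 1) (hρ : ∀ X : Op (TorusSite d L) q, 0 ≤ ρ (Xᴴ * X)) :
    ‖torusSpinExpect L Λ (Matrix.single s t (1 : ℂ)) ρ‖ ≤ 1 := by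
  by_cases h : Set.InjOn (Torus.proj (d := d) L) ↑Λ
  · rw [torusSpinExpect_of_injOn h]
    exact (state_norm_apply_le ρ h1 hρ _).trans (norm_spinEmbed_single_le_one _ s t)
  · rw [torusSpinExpect_of_not_injOn h, norm_zero]; exact zero_le_one

/-- **Single-site observables**: the torus expectation of `a` placed at `x` (the local algebra of `{x}`) is
`ρ(a at x mod L)`, for EVERY side `L` (no junk value: a singleton always fits). [cite: BratteliRobinsonII1997, §6.2.1] -/
theorem torusSpinExpect_onSite (x : Site d) (a : Matrix (Fin q) (Fin q) ℂ) (ρ : Op (TorusSite d L) q →ₗ[ℂ] ℂ) :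
    torusSpinExpect L {x} (onSite ⟨x, mem_singleton_self x⟩ a) ρ = ρ (onSite (Torus.proj L x) a) := by
  rw [torusSpinExpect_of_injOn (injOn_proj_singleton L x), spinEmbed_onSite, spinToTorusEmb_apply]

/-- **Two-site observables**: once `{x, y}` fits into the torus, the torus expectation of `(a at x)(b at y)`
is `ρ((a at x mod L)(b at y mod L))`. [cite: BratteliRobinsonII1997, §6.2.1] -/
theorem torusSpinExpect_onSite_mul_onSite {x y : Site d}
    (h : Set.InjOn (Torus.proj (d := d) L) ↑({x, y} : Finset (Site d)))
    (a b : Matrix (Fin q) (Fin q) ℂ) (ρ : Op (TorusSite d L) q →ₗ[ℂ] ℂ) :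
    torusSpinExpect L {x, y}
        (onSite ⟨x, mem_insert_self x {y}⟩ a * onSite ⟨y, mem_insert_of_mem (mem_singleton_self y)⟩ b) ρ =
      ρ (onSite (Torus.proj L x) a * onSite (Torus.proj L y) b) := by
  rw [torusSpinExpect_of_injOn h, map_mul, spinEmbed_onSite, spinEmbed_onSite, spinToTorusEmb_apply,
    spinToTorusEmb_apply]

/-! #### Translations: moving the region is conjugating by the torus translation unitary -/

omit [NeZero L] in
/-- `(x + v) mod L = (x mod L) + (v mod L)`, written with the torus affine map `torusAff 1 (v mod L)`.
[cite: BratteliRobinsonII1997, §6.2.1] -/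
theorem proj_add_eq_torusAff (v x : Site d) :
    Torus.proj L (x + v) = torusAff 1 (Torus.proj L v) (Torus.proj L x) := by
  have h : x + v = affSite 1 v x := by
    funext i; simp [affSite_apply]
  rw [h, Torus.proj_affSite]

omit [NeZero L] in
/-- Pulling the translated region `Λ + v` into the torus: `ι_{Λ+v,L} ∘ (x ↦ x + v) = T_{v mod L} ∘ ι_{Λ,L}`.
[cite: BratteliRobinsonII1997, §6.2.1] -/
theorem finsetMapEquiv_trans_spinToTorusEmb (v : Site d) (Λ : Finset (Site d))
    (h : Set.InjOn (Torus.proj (d := d) L) ↑Λ)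
    (h' : Set.InjOn (Torus.proj (d := d) L) ↑(Λ.map (Site.shift v).toEmbedding)) :
    (finsetMapEquiv (Site.shift v).toEmbedding Λ).toEmbedding.trans (spinToTorusEmb L h') =
      (spinToTorusEmb L h).trans (torusAff 1 (Torus.proj L v)).toEmbedding :=
  DFunLike.ext _ _ fun x => by
    rw [Function.Embedding.trans_apply, Function.Embedding.trans_apply, Equiv.coe_toEmbedding,
      Equiv.coe_toEmbedding, spinToTorusEmb_apply, spinToTorusEmb_apply, coe_finsetMapEquiv_apply]
    exact proj_add_eq_torusAff v x

/-- The tree's `transportOp e` (LocalDynamics) is the relabelling isomorphism `reindexOp e` (SpinSystem).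
[cite: BratteliRobinsonII1997, §6.2.1] -/
theorem transportOp_eq_reindexOp {X Z : Type*} [Fintype X] [DecidableEq X] [Fintype Z] [DecidableEq Z]
    (e : X ≃ Z) (A : Op X q) : transportOp e A = reindexOp e A := rfl

/-- **Translating the region is conjugating by the torus translation**: for `Λ` and `Λ + v` fitting into the
torus, `Γ(ι_{Λ+v,L})(τ_v A) = P Γ(ι_{Λ,L})(A) Pᴴ` with `P = permOp (torusAff 1 (v mod L))` the permutation
unitary of `y ↦ y + v mod L`. [cite: BratteliRobinsonII1997, §6.2.1] -/
theorem spinEmbed_toTorus_transportOp_shift (v : Site d) (Λ : Finset (Site d))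
    (h : Set.InjOn (Torus.proj (d := d) L) ↑Λ)
    (h' : Set.InjOn (Torus.proj (d := d) L) ↑(Λ.map (Site.shift v).toEmbedding)) (A : Op ↥Λ q) :
    spinEmbed (spinToTorusEmb L h') (transportOp (finsetMapEquiv (Site.shift v).toEmbedding Λ) A) =
      permOp (torusAff 1 (Torus.proj L v)) * spinEmbed (spinToTorusEmb L h) A *
        (permOp (torusAff 1 (Torus.proj L v)))ᴴ := by
  rw [transportOp_eq_reindexOp, ← spinEmbed_equiv, spinEmbed_spinEmbed,
    finsetMapEquiv_trans_spinToTorusEmb v Λ h h', permOp_conj_spinEmbed]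

/-- **Torus expectation of a translated observable**: if the torus state `ρ` is invariant under conjugation
by the translation `y ↦ y + v mod L`, the torus expectations of `τ_v A ∈ 𝔄_{Λ+v}` and of `A ∈ 𝔄_Λ` agree
(both regions fitting into the torus). [cite: BratteliRobinsonI1987, §4.3.1] -/
theorem torusSpinExpect_transportOp_shift (v : Site d) (Λ : Finset (Site d))
    (h : Set.InjOn (Torus.proj (d := d) L) ↑Λ)
    (h' : Set.InjOn (Torus.proj (d := d) L) ↑(Λ.map (Site.shift v).toEmbedding)) (A : Op ↥Λ q)
    {ρ : Op (TorusSite d L) q →ₗ[ℂ] ℂ}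
    (hρ : ∀ X : Op (TorusSite d L) q,
      ρ (permOp (torusAff 1 (Torus.proj L v)) * X * (permOp (torusAff 1 (Torus.proj L v)))ᴴ) = ρ X) :
    torusSpinExpect L (Λ.map (Site.shift v).toEmbedding)
        (transportOp (finsetMapEquiv (Site.shift v).toEmbedding Λ) A) ρ = torusSpinExpect L Λ A ρ := by
  rw [torusSpinExpect_of_injOn h', torusSpinExpect_of_injOn h, spinEmbed_toTorus_transportOp_shift v Λ h h',
    hρ]

end TorusExpect

/-! ### Torus-limit states -/

namespace InfVolState

variable {d q : ℕ}

/-- `ω` is the **thermodynamic limit of the torus states `ρ j`** (finite-volume states of the spin system on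
the tori `(ℤ/(Ls j)ℤ)^d`, all sides nonzero): for every finite region `Λ ⊆ ℤ^d` and every local observable
`A ∈ 𝔄_Λ`, the expectation of `A` pulled into the `j`-th torus converges to `ω_Λ(A)` as `j → ∞`.  This is
weak-⋆ convergence on the dense local algebra `⋃_Λ 𝔄_Λ`; divergence of the sides is not part of the
predicate (it is forced for the statements of interest and carried by the users), normalisation of the
`ρ j` is forced by `ω(𝟙) = 1`.  Bratteli–Robinson II §6.2.2 (thermodynamic limit with periodic boundary
conditions); Koma–Tasaki 1993 §1 (1.5), (1.8). [cite: BratteliRobinsonII1997, §6.2.2] -/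
def IsTorusLimitOf (ω : InfVolState d q) {Ls : ℕ → ℕ} [∀ j, NeZero (Ls j)]
    (ρ : ∀ j, Op (TorusSite d (Ls j)) q →ₗ[ℂ] ℂ) : Prop :=
  ∀ (Λ : Finset (Site d)) (A : Op ↥Λ q),
    Tendsto (fun j => torusSpinExpect (Ls j) Λ A (ρ j)) atTop (𝓝 (ω.expect Λ A))

variable {ω : InfVolState d q} {Ls : ℕ → ℕ} [∀ j, NeZero (Ls j)] {ρ : ∀ j, Op (TorusSite d (Ls j)) q →ₗ[ℂ] ℂ}

/-- The defining convergence. [cite: BratteliRobinsonII1997, §6.2.2] -/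
theorem IsTorusLimitOf.tendsto (h : ω.IsTorusLimitOf ρ) (Λ : Finset (Site d)) (A : Op ↥Λ q) :
    Tendsto (fun j => torusSpinExpect (Ls j) Λ A (ρ j)) atTop (𝓝 (ω.expect Λ A)) :=
  h Λ A

/-- **One-site expectations converge, with no junk values**: `ρ_j(a at x mod Ls j) → ω_{{x}}(a at x)`.
[cite: BratteliRobinsonII1997, §6.2.2] -/
theorem IsTorusLimitOf.tendsto_onSite (h : ω.IsTorusLimitOf ρ) (x : Site d) (a : Matrix (Fin q) (Fin q) ℂ) :
    Tendsto (fun j => ρ j (onSite (Torus.proj (Ls j) x) a)) atTop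
      (𝓝 (ω.expect {x} (onSite ⟨x, mem_singleton_self x⟩ a))) := by
  have h1 := h {x} (onSite ⟨x, mem_singleton_self x⟩ a)
  simp_rw [torusSpinExpect_onSite] at h1
  exact h1

/-- **Two-point functions converge** along diverging sides: `ρ_j((a at x)(b at y)) → ω.corr x y a b`.
[cite: BratteliRobinsonII1997, §6.2.2] -/
theorem IsTorusLimitOf.tendsto_corr (h : ω.IsTorusLimitOf ρ) (hLs : Tendsto Ls atTop atTop) (x y : Site d)
    (a b : Matrix (Fin q) (Fin q) ℂ) :
    Tendsto (fun j => ρ j (onSite (Torus.proj (Ls j) x) a * onSite (Torus.proj (Ls j) y) b)) atTop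
      (𝓝 (ω.corr x y a b)) := by
  refine (h {x, y} _).congr' ?_
  filter_upwards [eventually_injOn_proj_of_tendsto ({x, y} : Finset (Site d)) hLs] with j hj
  exact torusSpinExpect_onSite_mul_onSite hj a b (ρ j)

/-- Torus limits along a further subsequence. [cite: BratteliRobinsonII1997, §6.2.2] -/
theorem IsTorusLimitOf.comp_strictMono (h : ω.IsTorusLimitOf ρ) {φ : ℕ → ℕ} (hφ : StrictMono φ) :
    ω.IsTorusLimitOf (Ls := fun j => Ls (φ j)) (fun j => ρ (φ j)) :=
  fun Λ A => (h Λ A).comp hφ.tendsto_atTop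

/-- **Invariance under a lattice translation passes to the limit**: if (eventually) every torus state `ρ j`
is invariant under conjugation by the torus translation `y ↦ y + v mod Ls j`, and the sides diverge, then
the torus-limit state is invariant under `τ_v`: `ω ∘ τ_v = ω`.  (For a sublattice of translations `v` this
gives invariance under that sublattice — e.g. the even translations of a Néel state.)
[cite: BratteliRobinsonI1987, §4.3.1] -/
theorem IsTorusLimitOf.shift_eq_of_invariant (h : ω.IsTorusLimitOf ρ) (hLs : Tendsto Ls atTop atTop) (v : Site d)
    (hρ : ∀ᶠ j in atTop, ∀ X : Op (TorusSite d (Ls j)) q,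
      ρ j (permOp (torusAff 1 (Torus.proj (Ls j) v)) * X * (permOp (torusAff 1 (Torus.proj (Ls j) v)))ᴴ) =
        ρ j X) :
    ω.shift v = ω := by
  refine InfVolState.ext fun Λ => LinearMap.ext fun A => ?_
  rw [shift_expect]
  refine tendsto_nhds_unique (h _ _) ?_
  refine (h Λ A).congr' ?_
  filter_upwards [eventually_injOn_proj_of_tendsto Λ hLs,
    eventually_injOn_proj_of_tendsto (Λ.map (Site.shift v).toEmbedding) hLs, hρ] with j hj hj' hρj
  exact (torusSpinExpect_transportOp_shift v Λ hj hj' A hρj).symm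

/-- **Translation-invariant torus states have translation-invariant limits.**
[cite: BratteliRobinsonI1987, §4.3.1] -/
theorem IsTorusLimitOf.isTranslationInvariant (h : ω.IsTorusLimitOf ρ) (hLs : Tendsto Ls atTop atTop)
    (hρ : ∀ᶠ j in atTop, ∀ (w : TorusSite d (Ls j)) (X : Op (TorusSite d (Ls j)) q),
      ρ j (permOp (torusAff 1 w) * X * (permOp (torusAff 1 w))ᴴ) = ρ j X) :
    ω.IsTranslationInvariant :=
  fun v => h.shift_eq_of_invariant hLs v (hρ.mono fun _ hj X => hj _ X)

/-- Real parts converge along a torus limit. [cite: BratteliRobinsonII1997, §6.2.2] -/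
theorem IsTorusLimitOf.tendsto_re (h : ω.IsTorusLimitOf ρ) (Λ : Finset (Site d)) (A : Op ↥Λ q) :
    Tendsto (fun j => (torusSpinExpect (Ls j) Λ A (ρ j)).re) atTop (𝓝 (ω.expect Λ A).re) :=
  (Complex.continuous_re.tendsto _).comp (h Λ A)

/-- A lower bound holding eventually along the torus states passes to the limit (real parts).
[cite: BratteliRobinsonII1997, §6.2.2] -/
theorem IsTorusLimitOf.le_re_expect_of_eventually (h : ω.IsTorusLimitOf ρ) (Λ : Finset (Site d)) (A : Op ↥Λ q)
    {m : ℝ} (hm : ∀ᶠ j in atTop, m ≤ (torusSpinExpect (Ls j) Λ A (ρ j)).re) : m ≤ (ω.expect Λ A).re :=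
  ge_of_tendsto (h.tendsto_re Λ A) hm

end InfVolState

/-! ### Existence of torus-limit states: weak-⋆ compactness -/

section Compactness

variable {d q : ℕ}

/-- **THERMODYNAMIC-LIMIT STATES ALONG TORI EXIST (weak-⋆ compactness).**  For every family of normalised
(`ρ j 𝟙 = 1`) positive (`ρ j (Xᴴ X) ≥ 0`) linear functionals `ρ j` on the spin algebras of the tori
`(ℤ/(Ls j)ℤ)^d` with `Ls j → ∞` there are a subsequence `φ` (strictly increasing) and an infinite-volume state
`ω` of the quantum spin system on `ℤ^d` which is the torus limit of `ρ ∘ φ`: for every finite region `Λ` and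
every `A ∈ 𝔄_Λ`, `torusSpinExpect (Ls (φ j)) Λ A (ρ (φ j)) → ω_Λ(A)`.  Banach–Alaoglu for the separable
quasi-local algebra, by the Cantor–Tychonoff diagonal argument on the countably many matrix-unit coordinates
(each of modulus `≤ 1`, `norm_torusSpinExpect_single_le`); linearity, normalisation, positivity and
compatibility with isotony of the limit are closed conditions holding at every `j` as soon as the region fits
into the torus.  [cite: BratteliRobinsonI1987, Thm. 2.3.15 (weak-⋆ compactness of the state space) and §4.3.1] -/
theorem InfVolState.exists_isTorusLimitOf_subseq {Ls : ℕ → ℕ} [∀ j, NeZero (Ls j)] (hLs : Tendsto Ls atTop atTop)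
    (ρ : ∀ j, Op (TorusSite d (Ls j)) q →ₗ[ℂ] ℂ) (h1 : ∀ j, ρ j 1 = 1)
    (hpos : ∀ j (X : Op (TorusSite d (Ls j)) q), 0 ≤ ρ j (Xᴴ * X)) :
    ∃ φ : ℕ → ℕ, StrictMono φ ∧ ∃ ω : InfVolState d q,
      ω.IsTorusLimitOf (Ls := fun j => Ls (φ j)) (fun j => ρ (φ j)) := by
  classical
  -- coordinates: the values on the matrix units `|s⟩⟨t|` of all local algebras
  let c : ℕ → (Σ Λ : Finset (Site d), TensorIndex ↥Λ q × TensorIndex ↥Λ q) → ℂ :=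
    fun j i => torusSpinExpect (Ls j) i.1 (Matrix.single i.2.1 i.2.2 (1 : ℂ)) (ρ j)
  have hK : IsCompact (Set.pi Set.univ fun _ :
      (Σ Λ : Finset (Site d), TensorIndex ↥Λ q × TensorIndex ↥Λ q) => Metric.closedBall (0 : ℂ) 1) :=
    isCompact_univ_pi fun _ => isCompact_closedBall (0 : ℂ) 1
  have hc : ∀ j, c j ∈ Set.pi Set.univ fun _ :
      (Σ Λ : Finset (Site d), TensorIndex ↥Λ q × TensorIndex ↥Λ q) => Metric.closedBall (0 : ℂ) 1 :=
    fun j i _ => by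
      rw [Metric.mem_closedBall, dist_zero_right]
      exact norm_torusSpinExpect_single_le _ _ _ (h1 j) (hpos j)
  obtain ⟨g, -, φ, hφ, hg⟩ := hK.tendsto_subseq hc
  have hcoord : ∀ i : (Σ Λ : Finset (Site d), TensorIndex ↥Λ q × TensorIndex ↥Λ q),
      Tendsto (fun j => c (φ j) i) atTop (𝓝 (g i)) := fun i => tendsto_pi_nhds.1 hg i
  -- the limit functional and the convergence of all torus expectations along the subsequence
  let lim : ∀ Λ : Finset (Site d), Op ↥Λ q → ℂ := fun Λ A => ∑ s, ∑ t, A s t * g ⟨Λ, (s, t)⟩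
  have hlim : ∀ (Λ : Finset (Site d)) (A : Op ↥Λ q),
      Tendsto (fun j => torusSpinExpect (Ls (φ j)) Λ A (ρ (φ j))) atTop (𝓝 (lim Λ A)) := by
    intro Λ A
    simp_rw [torusSpinExpect_eq_sum_single Λ A]
    refine tendsto_finsetSum _ fun s _ => tendsto_finsetSum _ fun t _ => ?_
    exact (hcoord ⟨Λ, (s, t)⟩).const_mul _
  have hLφ : Tendsto (fun j => Ls (φ j)) atTop atTop := hLs.comp hφ.tendsto_atTop
  -- the limit functional is linear
  let E : ∀ Λ : Finset (Site d), Op ↥Λ q →ₗ[ℂ] ℂ := fun Λ =>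
    { toFun := lim Λ
      map_add' := fun A B => by
        simp only [lim, Matrix.add_apply, add_mul, Finset.sum_add_distrib]
      map_smul' := fun a A => by
        simp only [lim, Matrix.smul_apply, smul_eq_mul, mul_assoc, Finset.mul_sum, RingHom.id_apply] }
  -- normalisation
  have h_one : ∀ Λ : Finset (Site d), E Λ 1 = 1 := by
    intro Λ
    refine tendsto_nhds_unique (hlim Λ 1) ?_
    refine (tendsto_const_nhds (x := (1 : ℂ))).congr' ?_
    filter_upwards [eventually_injOn_proj_of_tendsto Λ hLφ] with j hj
    exact (torusSpinExpect_one hj (h1 (φ j))).symm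
  -- positivity
  have h_nonneg : ∀ (Λ : Finset (Site d)) (A : Op ↥Λ q), 0 ≤ E Λ (Aᴴ * A) := fun Λ A =>
    ge_of_tendsto' (hlim Λ (Aᴴ * A)) fun j => torusSpinExpect_conjTranspose_mul_self_nonneg _ _ (hpos (φ j))
  -- compatibility
  have h_comp : ∀ ⦃Λ Λ' : Finset (Site d)⦄ (h : Λ ⊆ Λ') (A : Op ↥Λ q), E Λ' (embedOp h A) = E Λ A := by
    intro Λ Λ' h A
    refine tendsto_nhds_unique (hlim Λ' (embedOp h A)) ?_
    refine (hlim Λ A).congr' ?_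
    filter_upwards [eventually_injOn_proj_of_tendsto Λ' hLφ] with j hj
    exact (torusSpinExpect_embedOp h hj A _).symm
  exact ⟨φ, hφ, ⟨E, h_one, h_nonneg, h_comp⟩, fun Λ A => hlim Λ A⟩

/-- **Torus limits of Gibbs states exist.**  For Hermitian Hamiltonians `H j` on the tori of sides
`Ls j → ∞` and any inverse temperatures `β j`, a subsequence of the Gibbs states `⟨·⟩_{β j, H j}` has a
thermodynamic limit (the Gibbs state is normalised and positive: tree `Matrix.gibbsState_one`,
`Matrix.gibbsState_nonneg_of_posSemidef`).  Bratteli–Robinson II §6.2.2; Koma–Tasaki 1993 (1.5).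
[cite: BratteliRobinsonII1997, §6.2.2] -/
theorem InfVolState.exists_isTorusLimitOf_subseq_gibbsState {n : ℕ} {Ls : ℕ → ℕ} [∀ j, NeZero (Ls j)]
    (hLs : Tendsto Ls atTop atTop) (β : ℕ → ℝ) (H : ∀ j, Op (TorusSite d (Ls j)) (n + 1))
    (hH : ∀ j, (H j).IsHermitian) :
    ∃ φ : ℕ → ℕ, StrictMono φ ∧ ∃ ω : InfVolState d (n + 1),
      ω.IsTorusLimitOf (Ls := fun j => Ls (φ j)) (fun j => Matrix.gibbsState (β (φ j)) (H (φ j))) := by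
  refine InfVolState.exists_isTorusLimitOf_subseq hLs (fun j => Matrix.gibbsState (β j) (H j))
    (fun j => Matrix.gibbsState_one (β j) (H j) (Matrix.partitionFn_pos (β j) (hH j)).ne') fun j X => ?_
  exact Matrix.gibbsState_nonneg_of_posSemidef (β j) (hH j) (Matrix.posSemidef_conjTranspose_mul_self X)

/-- **Torus limits of (tracial) ground states exist.**  For Hermitian Hamiltonians `H j` on the tori of sides
`Ls j → ∞`, a subsequence of the tracial ground states `tr(P₀ ·)/tr P₀` (`Matrix.groundStateFunctional`, the
`β → ∞` limit of the Gibbs states) has a thermodynamic limit.  Bratteli–Robinson II §6.2.2; Koma–Tasaki 1993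
§1 (the ground state obtained by `β → ∞` in finite volume). [cite: BratteliRobinsonII1997, §6.2.2] -/
theorem InfVolState.exists_isTorusLimitOf_subseq_groundStateFunctional {n : ℕ} {Ls : ℕ → ℕ}
    [∀ j, NeZero (Ls j)] (hLs : Tendsto Ls atTop atTop) (H : ∀ j, Op (TorusSite d (Ls j)) (n + 1))
    (hH : ∀ j, (H j).IsHermitian) :
    ∃ φ : ℕ → ℕ, StrictMono φ ∧ ∃ ω : InfVolState d (n + 1),
      ω.IsTorusLimitOf (Ls := fun j => Ls (φ j)) (fun j => Matrix.groundStateFunctional (H (φ j))) := by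
  refine InfVolState.exists_isTorusLimitOf_subseq hLs (fun j => Matrix.groundStateFunctional (H j))
    (fun j => Matrix.groundStateFunctional_one (hH j)) fun j X => ?_
  exact Matrix.groundStateFunctional_nonneg (H j) X

end Compactness

/-! ### Pointwise (weak-⋆) limits of infinite-volume spin states -/

namespace InfVolState

variable {d q : ℕ}

/-- **Expansion in matrix units**: `ω_Λ(A) = Σ_{s,t} A_{st} · ω_Λ(|s⟩⟨t|)`. [cite: BratteliRobinsonI1987, §2.6] -/
theorem expect_eq_sum_single (ω : InfVolState d q) (Λ : Finset (Site d)) (A : Op ↥Λ q) :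
    ω.expect Λ A = ∑ s, ∑ t, A s t * ω.expect Λ (Matrix.single s t (1 : ℂ)) := by
  conv_lhs => rw [matrix_eq_sum_single A, map_sum]
  simp only [map_sum]
  refine Finset.sum_congr rfl fun s _ => Finset.sum_congr rfl fun t _ => ?_
  rw [← smul_eq_mul, ← map_smul, smul_single, smul_eq_mul, mul_one]

open scoped Matrix.Norms.L2Operator in
/-- **Sequential Banach–Alaoglu for quantum spin systems.**  Every sequence `ω_j` of infinite-volume states
of the spin system on `ℤ^d` has a subsequence `ω_{φ j}` and a state `ωl` with `ω_{φ j, Λ}(A) → ωl_Λ(A)` for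
every finite region `Λ` and every `A ∈ 𝔄_Λ` (the fermionic twin is
`InfVolFermionState.exists_tendsto_expect_subseq`).  Tychonoff on the matrix-unit coordinates, each in the
closed disc of radius `‖|s⟩⟨t|‖` (`norm_expect_le`). [cite: BratteliRobinsonI1987, Thm. 2.3.15] -/
theorem exists_tendsto_expect_subseq (ω : ℕ → InfVolState d q) :
    ∃ φ : ℕ → ℕ, StrictMono φ ∧ ∃ ωl : InfVolState d q,
      ∀ (Λ : Finset (Site d)) (A : Op ↥Λ q),
        Tendsto (fun j => (ω (φ j)).expect Λ A) atTop (𝓝 (ωl.expect Λ A)) := by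
  classical
  let c : ℕ → (Σ Λ : Finset (Site d), TensorIndex ↥Λ q × TensorIndex ↥Λ q) → ℂ :=
    fun j i => (ω j).expect i.1 (Matrix.single i.2.1 i.2.2 (1 : ℂ))
  let r : (Σ Λ : Finset (Site d), TensorIndex ↥Λ q × TensorIndex ↥Λ q) → ℝ :=
    fun i => ‖(Matrix.single i.2.1 i.2.2 (1 : ℂ) : Op ↥i.1 q)‖
  have hK : IsCompact (Set.pi Set.univ fun i :
      (Σ Λ : Finset (Site d), TensorIndex ↥Λ q × TensorIndex ↥Λ q) => Metric.closedBall (0 : ℂ) (r i)) :=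
    isCompact_univ_pi fun i => isCompact_closedBall (0 : ℂ) (r i)
  have hc : ∀ j, c j ∈ Set.pi Set.univ fun i :
      (Σ Λ : Finset (Site d), TensorIndex ↥Λ q × TensorIndex ↥Λ q) => Metric.closedBall (0 : ℂ) (r i) :=
    fun j i _ => by
      rw [Metric.mem_closedBall, dist_zero_right]
      exact (ω j).norm_expect_le_holds _ _
  obtain ⟨g, -, φ, hφ, hg⟩ := hK.tendsto_subseq hc
  have hcoord : ∀ i : (Σ Λ : Finset (Site d), TensorIndex ↥Λ q × TensorIndex ↥Λ q),
      Tendsto (fun j => c (φ j) i) atTop (𝓝 (g i)) := fun i => tendsto_pi_nhds.1 hg i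
  let lim : ∀ Λ : Finset (Site d), Op ↥Λ q → ℂ := fun Λ A => ∑ s, ∑ t, A s t * g ⟨Λ, (s, t)⟩
  have hlim : ∀ (Λ : Finset (Site d)) (A : Op ↥Λ q),
      Tendsto (fun j => (ω (φ j)).expect Λ A) atTop (𝓝 (lim Λ A)) := by
    intro Λ A
    have hrw : (fun j => (ω (φ j)).expect Λ A) =
        fun j => ∑ s, ∑ t, A s t * (ω (φ j)).expect Λ (Matrix.single s t (1 : ℂ)) :=
      funext fun j => expect_eq_sum_single _ Λ A
    rw [hrw]
    refine tendsto_finsetSum _ fun s _ => tendsto_finsetSum _ fun t _ => ?_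
    exact (hcoord ⟨Λ, (s, t)⟩).const_mul _
  let E : ∀ Λ : Finset (Site d), Op ↥Λ q →ₗ[ℂ] ℂ := fun Λ =>
    { toFun := lim Λ
      map_add' := fun A B => by
        simp only [lim, Matrix.add_apply, add_mul, Finset.sum_add_distrib]
      map_smul' := fun a A => by
        simp only [lim, Matrix.smul_apply, smul_eq_mul, mul_assoc, Finset.mul_sum, RingHom.id_apply] }
  have h_one : ∀ Λ : Finset (Site d), E Λ 1 = 1 := by
    intro Λ
    refine tendsto_nhds_unique (hlim Λ 1) ?_
    have hrw : (fun j => (ω (φ j)).expect Λ 1) = fun _ => (1 : ℂ) := funext fun j => (ω (φ j)).expect_one Λ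
    rw [hrw]
    exact tendsto_const_nhds
  have h_nonneg : ∀ (Λ : Finset (Site d)) (A : Op ↥Λ q), 0 ≤ E Λ (Aᴴ * A) := fun Λ A =>
    ge_of_tendsto' (hlim Λ (Aᴴ * A)) fun j => (ω (φ j)).expect_nonneg Λ A
  have h_comp : ∀ ⦃Λ Λ' : Finset (Site d)⦄ (h : Λ ⊆ Λ') (A : Op ↥Λ q), E Λ' (embedOp h A) = E Λ A := by
    intro Λ Λ' h A
    refine tendsto_nhds_unique (hlim Λ' (embedOp h A)) ?_
    have hrw : (fun j => (ω (φ j)).expect Λ' (embedOp h A)) = fun j => (ω (φ j)).expect Λ A :=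
      funext fun j => (ω (φ j)).compatible h A
    rw [hrw]
    exact hlim Λ A
  exact ⟨φ, hφ, ⟨E, h_one, h_nonneg, h_comp⟩, fun Λ A => hlim Λ A⟩

/-- **Invariance under a translation is closed under pointwise limits**: if `ω_j ∘ τ_v = ω_j` for every `j`
and `ω_{j,Λ}(A) → ωl_Λ(A)` for all `Λ, A`, then `ωl ∘ τ_v = ωl`. [cite: BratteliRobinsonI1987, §4.3.1] -/
theorem shift_eq_of_tendsto_expect {ω : ℕ → InfVolState d q} {ωl : InfVolState d q}
    (hlim : ∀ (Λ : Finset (Site d)) (A : Op ↥Λ q),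
      Tendsto (fun j => (ω j).expect Λ A) atTop (𝓝 (ωl.expect Λ A)))
    (v : Site d) (hv : ∀ j, (ω j).shift v = ω j) : ωl.shift v = ωl := by
  refine InfVolState.ext fun Λ => LinearMap.ext fun A => ?_
  rw [shift_expect]
  refine tendsto_nhds_unique (hlim _ _) ?_
  have hrw : (fun j => (ω j).expect (Λ.map (Site.shift v).toEmbedding)
      (transportOp (finsetMapEquiv (Site.shift v).toEmbedding Λ) A)) = fun j => (ω j).expect Λ A := by
    funext j
    rw [← shift_expect, hv j]
  rw [hrw]
  exact hlim Λ A

/-- Real parts of one local expectation converge along a pointwise limit, and an eventual lower bound passes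
to the limit. [cite: BratteliRobinsonI1987, Thm. 2.3.15] -/
theorem le_re_expect_of_tendsto_expect {ω : ℕ → InfVolState d q} {ωl : InfVolState d q}
    (hlim : ∀ (Λ : Finset (Site d)) (A : Op ↥Λ q),
      Tendsto (fun j => (ω j).expect Λ A) atTop (𝓝 (ωl.expect Λ A)))
    (Λ : Finset (Site d)) (A : Op ↥Λ q) {m : ℝ} (hm : ∀ᶠ j in atTop, m ≤ ((ω j).expect Λ A).re) :
    m ≤ (ωl.expect Λ A).re :=
  ge_of_tendsto ((Complex.continuous_re.tendsto _).comp (hlim Λ A)) hm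

end InfVolState

end Literature.MathematicalPhysics.QuantumLattice

end
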